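import Summits.QuantumFields.YangMills.Theorems.UnitScaleTiltProp8ChartDoubleBarBall
import Literature.Analysis.Matrix.DetExp
import HarnessLib

/-!
# Route `UnitScaleTilt`, crux K1 «MinimiserStabilityRegPr» (stmt-QuantumFields-19200), stub V2′ `stub_halvingStep` — pillar P3, the double-bar chart of record
# (★★OWNER RULING g26-№6∕№7; defs ✓`Prop8ChartDoubleBar`): **THE TWO 𝔰𝔲(2) HYGIENE ROWS OF THE (H-E2E) CENSUS (RULING g26-№16 (3))** — `chartLogFlat η D A (j,c) = −i·log U̿^{(j)}(e^{iηA})(c)`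
# is TRACELESS for bondwise-traceless `A` and SELF-ADJOINT for bondwise-self-adjoint `A`, on the read territory of the index (GUARDED: the series logarithm needs
# `‖U̿ − 1‖ ≤ 1∕3`, supplied by the B1∕B2 near-flatness ✓`norm_dbarIterU_sub_one_le_two_mul₀` under its budget)

Cell `ym3-torus` (HUMAN RULING D-0037: YM₃ on the torus is ladder rung R3, not the Clay problem), width seat `ym-ust-19200-w8` g0∕s2.
`--supports stmt-QuantumFields-19200 --as helper`; definition-free, 0 sorry.

WHY (census `H-E2E-CENSUS-w8s2.md`, evidence #53, rows S11 `hΨsa` and S15 hCtr♭).  The (165)-A₁ row of record (✓`HalvingA1Row165TraceSU2.row165_of_tracePairing_L5_su2`) and the P5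
entry (✓`HalvingDressedCriticalitySU2.tracePairing_of_isMinOn_dressed_wilson_su2`) read the chart field in 𝔰𝔲(2): bondwise traceless and self-adjoint.  For the Thm-2 field `A`
that is pillar P1; for the chart preimage `A′ = A + Hs(C♭ A)` and the dressed competitors `X − Hs(D X)` it needs the remainder `C♭ = Q♭ − Q_lin` to preserve both properties —
i.e. `Q♭ = chartLogFlat` itself (its linear part `η·Lʲ·Q_j`, ✓`fderiv_chartLogFlat_zero_apply`, has real coefficients).  Print: [Balaban1987RG1] p.253 «`exp[mean log]` is a
`Gᶜ`-valued function defined on sets `{U_j}`, `U_j ∈ Gᶜ`, with sufficiently small diameters»; [Balaban1985Averaging] (23) «`iA` skew-Hermitian».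

WHAT THIS FILE PROVES (no definition, no sorry):
* §1 `holT_pred_of_walk` — a multiplicative predicate (`p 1`, closed under `*` and `⁻¹`) holding on the bonds READ by a walk holds on its transporter (any group).
* §2 (on `M₂(ℂ)ˣ`-fields, L²-operator norm) **`pred_dbarAvgU`** — one double-bar step preserves any such predicate that `exp[mean log]` preserves on `1∕3`-small tuples
  (`Idx P`-indexed), given two-block near-flatness `12ℓs ≤ 1`; **`pred_dbarIterU_of_reads`** — the iterate on the read territory under the B2 budget `30400·ℓ²·Lⁱ·s₀ ≤ 1`
  (induction of ✓`differentiableAt_coe_dbarIterU_of_reads`); instances **`det_dbarIterU_eq_one_of_reads`** (`det = 1`, via ✓`ExpMeanLog.det_eml_eq_one`) and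
  **`dbarIterU_mem_unitaryGroup_of_reads`** (unitary, via ✓`ExpMeanLog.eml_mem_unitaryGroup`); bases `det_coe_expCfg_eq_one` (traceless ⇒ `det e^{iηA} = 1`, Liouville
  ✓`Literature.Analysis.Matrix.det_exp_eq_exp_trace`) and `coe_expCfg_mem_unitaryGroup` (self-adjoint ⇒ `e^{iηA}` unitary, `NormedSpace.exp_mem_unitary_of_mem_skewAdjoint`).
* §3 ★ **`trace_chartLogFlat_eq_zero_of_reads`**, ★ **`isSelfAdjoint_chartLogFlat_of_reads`** (index form, hypotheses of ✓`norm_chartLogFlat_apply_le_of_reads` with B1 plugged)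
  and the weighted-ball forms of record ★★ **`trace_chartLogFlat_eq_zero_weightedBall₀`**, ★★ **`isSelfAdjoint_chartLogFlat_weightedBall₀`** (letters of
  ✓`norm_chartLogFlat_le_weightedBall₀`: level weights, collar, `60800·ℓ²·L·R ≤ 1`, `w₁‖A‖ < R`).
HONEST SCOPE.  Bookkeeping over landed letters; `hΨsa` (self-adjointness of the DRESSED competitors) needs in addition the uniqueness of the (49) small solution — not here.  NOT a claim about the stub, the crux, the rung or the gap.

References: T. Bałaban, CMP **109** (1987) [Balaban1987RG1] (0.4)–(0.9) p.253; CMP **98** (1985) [Balaban1985Averaging] (23), (89), (110); CMP **102** (1985) [Balaban1985Variational] (20), (152).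
-/

set_option autoImplicit false

noncomputable section

open scoped BigOperators
open NormedSpace

namespace Summit.QuantumFields.YangMills.Theorems.Prop8ChartDoubleBar

open Literature.MathematicalPhysics.QuantumFieldTheory.Balaban1983to89
open T4Continuum BlockAveraging AveragingRT ExpMeanLog MatrixLog
open B10Eq27TorusAxialLog (holT holT_nil holT_cons_true holT_cons_false)
open B5Eq118OneStroke (iterBlockOf iterBlockOf_succ iterBlockOf_zero)
open B6SectADomainsV1 (Domains)
open B6SectAOperatorsV1 (BondIdx)
open T3ContinuumYM3Torus (T3Family)
open Summit.QuantumFields.YangMills.Theorems.FlatCubeOpsText (IsLevWeight)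
open Summit.QuantumFields.YangMills.Theorems.Prop8Chart

variable {P : Params}

/-! ## §1 Multiplicative predicates along transporters -/

section Pred

variable {G : Type*} [Group G] {j : ℕ}

/-- **A MULTIPLICATIVE PREDICATE READ ALONG A WALK PASSES TO THE TRANSPORTER**: if `p 1`, `p` is closed under `*` and `⁻¹`, and `p (V b)` for every bond `b` read by the walk
spelled by `w` from `x`, then `p (V(Γ_{x,w}))` (telescoping bookkeeping of (9)). [cite: Balaban1985Averaging, (8)-(9) pp.18-19] -/
theorem holT_pred_of_walk (p : G → Prop) (h1 : p 1) (hmul : ∀ a b, p a → p b → p (a * b)) (hinv : ∀ a, p a → p a⁻¹)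
    (V : GaugeField P j G) : ∀ (x : Site P j) (w : List (Letter P.d)), (∀ st ∈ walk x w, p (V st.bond)) → p (holT V x w)
  | x, [], _ => by rw [holT_nil]; exact h1
  | x, (μ, true) :: w, h => by
    rw [holT_cons_true]
    have hcons : walk x ((μ, true) :: w) = ⟨⟨x, μ⟩, true⟩ :: walk (x.shift μ) w := rfl
    refine hmul _ _ (h ⟨⟨x, μ⟩, true⟩ (by rw [hcons]; exact List.mem_cons_self)) ?_
    exact holT_pred_of_walk p h1 hmul hinv V (x.shift μ) w fun st hst => h st (by rw [hcons]; exact List.mem_cons_of_mem _ hst)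
  | x, (μ, false) :: w, h => by
    rw [holT_cons_false]
    have hcons : walk x ((μ, false) :: w) = ⟨⟨x.unshift μ, μ⟩, false⟩ :: walk (x.unshift μ) w := rfl
    refine hmul _ _ (hinv _ (h ⟨⟨x.unshift μ, μ⟩, false⟩ (by rw [hcons]; exact List.mem_cons_self))) ?_
    exact holT_pred_of_walk p h1 hmul hinv V (x.unshift μ) w fun st hst => h st (by rw [hcons]; exact List.mem_cons_of_mem _ hst)

end Pred

/-! ## §2 `det = 1` and unitarity through the double-bar tower on `M₂(ℂ)ˣ`-fields -/

section SU2

open scoped Matrix.Norms.L2Operator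

/-- `2·(1∕3) < π`: the winding guard of the series logarithm on `2 × 2` matrices is automatic below `1∕3`. [folklore] -/
theorem two_mul_lt_pi_of_le_third {t : ℝ} (ht : t ≤ 1 / 3) : (Fintype.card (Fin 2) : ℝ) * t < Real.pi := by
  rw [Fintype.card_fin]; push_cast; nlinarith [Real.pi_gt_three]

/-- **ONE DOUBLE-BAR STEP PRESERVES A MULTIPLICATIVE `eml`-STABLE PREDICATE** on the two blocks of `c`: `p` holds on `U̿(c) = v(c₋)⁻¹·Ū(c)·v(c₊)` as soon as it holds on the
two-block bonds, which are within `s` of `1`, `12ℓs ≤ 1` (loops and centre stairs are then within `4ℓs ≤ 1∕3` of `1`: ✓`norm_loopHolU_sub_one_le`, ✓`norm_holT_stair_sub_one_le`).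
[cite: Balaban1987RG1, (0.4)-(0.9) p.253; Balaban1985Averaging, (89) p.31, (110) p.34] -/
theorem pred_dbarAvgU {j : ℕ} (p : Matrix (Fin 2) (Fin 2) ℂ → Prop) (h1 : p 1) (hmul : ∀ a b, p a → p b → p (a * b))
    (hinv : ∀ u : (Matrix (Fin 2) (Fin 2) ℂ)ˣ, p (u : Matrix (Fin 2) (Fin 2) ℂ) → p ((u⁻¹ : (Matrix (Fin 2) (Fin 2) ℂ)ˣ) : Matrix (Fin 2) (Fin 2) ℂ))
    (heml : ∀ W : Idx P → Matrix (Fin 2) (Fin 2) ℂ, (∀ i, p (W i)) → (∀ i, ‖W i - 1‖ ≤ 1 / 3) → p (eml W))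
    (hj : j + 1 ≤ P.m + P.K) {S : GaugeField P j (Matrix (Fin 2) (Fin 2) ℂ)ˣ} (c : PBond P (j + 1)) {s : ℝ} (hs0 : 0 ≤ s)
    (hℓs : 12 * (((P.d + 2) * P.L : ℕ) : ℝ) * s ≤ 1)
    (hS : ∀ b : PBond P j, (blockOf b.src = c.src ∨ blockOf b.src = c.tgt) → (blockOf b.tgt = c.src ∨ blockOf b.tgt = c.tgt) →
      ‖((S b : (Matrix (Fin 2) (Fin 2) ℂ)ˣ) : Matrix (Fin 2) (Fin 2) ℂ) - 1‖ ≤ s)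
    (hp : ∀ b : PBond P j, (blockOf b.src = c.src ∨ blockOf b.src = c.tgt) → (blockOf b.tgt = c.src ∨ blockOf b.tgt = c.tgt) →
      p ((S b : (Matrix (Fin 2) (Fin 2) ℂ)ˣ) : Matrix (Fin 2) (Fin 2) ℂ)) :
    p ((dbarAvgU S c : (Matrix (Fin 2) (Fin 2) ℂ)ˣ) : Matrix (Fin 2) (Fin 2) ℂ) := by
  have hℓs4 : 4 * (((P.d + 2) * P.L : ℕ) : ℝ) * s ≤ 1 := by
    have : 0 ≤ (((P.d + 2) * P.L : ℕ) : ℝ) * s := by positivity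
    linarith
  have hthird : 4 * (((P.d + 2) * P.L : ℕ) : ℝ) * s ≤ 1 / 3 := by
    have : 0 ≤ (((P.d + 2) * P.L : ℕ) : ℝ) * s := by positivity
    linarith
  -- the predicate on units-valued transporters, read along walks
  have hpu : ∀ (x : Site P j) (w : List (Letter P.d)), (∀ st ∈ walk x w, p ((S st.bond : (Matrix (Fin 2) (Fin 2) ℂ)ˣ) : Matrix (Fin 2) (Fin 2) ℂ)) →
      p ((holT S x w : (Matrix (Fin 2) (Fin 2) ℂ)ˣ) : Matrix (Fin 2) (Fin 2) ℂ) := fun x w hw =>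
    holT_pred_of_walk (fun u : (Matrix (Fin 2) (Fin 2) ℂ)ˣ => p (u : Matrix (Fin 2) (Fin 2) ℂ)) (by rw [Units.val_one]; exact h1)
      (fun a b ha hb => by rw [Units.val_mul]; exact hmul _ _ ha hb) hinv S x w hw
  -- the frames at the two ends
  have hframe : ∀ y : Site P (j + 1), (y = c.src ∨ y = c.tgt) → p ((vframeU S y : (Matrix (Fin 2) (Fin 2) ℂ)ˣ) : Matrix (Fin 2) (Fin 2) ℂ) := by
    intro y hy
    rw [coe_vframeU]
    have hSy : ∀ b : PBond P j, blockOf b.src = y → blockOf b.tgt = y → ‖((S b : (Matrix (Fin 2) (Fin 2) ℂ)ˣ) : Matrix (Fin 2) (Fin 2) ℂ) - 1‖ ≤ s := by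
      intro b hb1 hb2
      refine hS b ?_ ?_
      · rw [hb1]; exact hy
      · rw [hb2]; exact hy
    refine heml _ (fun i => hpu _ _ fun st hst => hp st.bond ?_ ?_) fun i => ((norm_holT_stair_sub_one_le hj y hs0 hℓs4 hSy i).1).trans hthird
    · rw [(blockOf_ends_of_mem_stairWalk hj y i.1 i.2.1 st hst).1]; exact hy
    · rw [(blockOf_ends_of_mem_stairWalk hj y i.1 i.2.1 st hst).2]; exact hy
  -- the single-bar average: `eml` of the loops times the straight transporter
  have havg : p ((emlAvgU S c : (Matrix (Fin 2) (Fin 2) ℂ)ˣ) : Matrix (Fin 2) (Fin 2) ℂ) := by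
    rw [coe_emlAvgU]
    refine hmul _ _ (heml _ (fun i => ?_) fun i => ((norm_loopHolU_sub_one_le hj c hs0 hℓs4 hS i).1).trans hthird) ?_
    · exact hpu _ _ fun st hst => hp st.bond (two_block_of_mem_loopWalk hj c i hst).1 (two_block_of_mem_loopWalk hj c i hst).2
    · exact hpu _ _ fun st hst => hp st.bond (two_block_of_mem_lineWalk hj c hst).1 (two_block_of_mem_lineWalk hj c hst).2
  rw [coe_dbarAvgU]
  exact hmul _ _ (hmul _ _ (hinv _ (hframe c.src (Or.inl rfl))) havg) (hframe c.tgt (Or.inr rfl))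

/-- **THE DOUBLE-BAR TOWER PRESERVES A MULTIPLICATIVE `eml`-STABLE PREDICATE ON THE READ TERRITORY**: if `p` holds on and the field is within `s₀` of `1` on every fine
bond whose level-`i` blocks lie in `S`, `30400·ℓ²·Lⁱ·s₀ ≤ 1`, then `p (U̿^{(i)}(e))` for every `e` with both ends in `S` (induction of ✓`differentiableAt_coe_dbarIterU_of_reads`,
near-flatness by ✓`norm_dbarIterU_sub_one_le_two_mul₀`). [cite: Balaban1985Averaging, Prop. 4 (134)-(135) p.38; Balaban1987RG1, (0.9) p.253] -/
theorem pred_dbarIterU_of_reads (p : Matrix (Fin 2) (Fin 2) ℂ → Prop) (h1 : p 1) (hmul : ∀ a b, p a → p b → p (a * b))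
    (hinv : ∀ u : (Matrix (Fin 2) (Fin 2) ℂ)ˣ, p (u : Matrix (Fin 2) (Fin 2) ℂ) → p ((u⁻¹ : (Matrix (Fin 2) (Fin 2) ℂ)ˣ) : Matrix (Fin 2) (Fin 2) ℂ))
    (heml : ∀ W : Idx P → Matrix (Fin 2) (Fin 2) ℂ, (∀ i, p (W i)) → (∀ i, ‖W i - 1‖ ≤ 1 / 3) → p (eml W)) :
    ∀ (i : ℕ), i ≤ P.m + P.K → ∀ (S : Set (Site P i)) (U : GaugeField P 0 (Matrix (Fin 2) (Fin 2) ℂ)ˣ) (s₀ : ℝ), 0 ≤ s₀ →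
      8 * 3800 * (((P.d + 2) * P.L : ℕ) : ℝ) ^ 2 * (P.L : ℝ) ^ i * s₀ ≤ 1 →
      (∀ b : PBond P 0, iterBlockOf i b.src ∈ S → iterBlockOf i b.tgt ∈ S → ‖((U b : (Matrix (Fin 2) (Fin 2) ℂ)ˣ) : Matrix (Fin 2) (Fin 2) ℂ) - 1‖ ≤ s₀) →
      (∀ b : PBond P 0, iterBlockOf i b.src ∈ S → iterBlockOf i b.tgt ∈ S → p ((U b : (Matrix (Fin 2) (Fin 2) ℂ)ˣ) : Matrix (Fin 2) (Fin 2) ℂ)) →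
      ∀ e : PBond P i, e.src ∈ S → e.tgt ∈ S → p ((dbarIterU i U e : (Matrix (Fin 2) (Fin 2) ℂ)ˣ) : Matrix (Fin 2) (Fin 2) ℂ) := by
  set ℓ : ℝ := (((P.d + 2) * P.L : ℕ) : ℝ) with hℓ
  have hℓ1 : (1 : ℝ) ≤ ℓ := by
    rw [hℓ]; exact_mod_cast Nat.one_le_iff_ne_zero.mpr (Nat.mul_ne_zero (by omega) (by have := P.hL.2; omega))
  have hL1 : (1 : ℝ) ≤ P.L := by exact_mod_cast P.L_pos
  intro i
  induction i with
  | zero =>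
    intro _ S U s₀ _ _ _ hpU e hs ht
    rw [dbarIterU_zero]
    exact hpU e (by simpa only [iterBlockOf_zero] using hs) (by simpa only [iterBlockOf_zero] using ht)
  | succ i ih =>
    intro hi S U s₀ hs₀ hbudget hU hpU c hcs hct
    have hbudget_i : 8 * 3800 * ℓ ^ 2 * (P.L : ℝ) ^ i * s₀ ≤ 1 := by
      refine le_trans ?_ hbudget
      have : (P.L : ℝ) ^ i ≤ (P.L : ℝ) ^ (i + 1) := pow_le_pow_right₀ hL1 (Nat.le_succ i)
      have h0 : 0 ≤ 8 * 3800 * ℓ ^ 2 * s₀ := by positivity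
      nlinarith
    set S' : Set (Site P i) := {y | blockOf y ∈ S} with hS'
    have hU' : ∀ b : PBond P 0, iterBlockOf i b.src ∈ S' → iterBlockOf i b.tgt ∈ S' →
        ‖((U b : (Matrix (Fin 2) (Fin 2) ℂ)ˣ) : Matrix (Fin 2) (Fin 2) ℂ) - 1‖ ≤ s₀ :=
      fun b hs ht => hU b (by rw [iterBlockOf_succ]; exact hs) (by rw [iterBlockOf_succ]; exact ht)
    have hpU' : ∀ b : PBond P 0, iterBlockOf i b.src ∈ S' → iterBlockOf i b.tgt ∈ S' →
        p ((U b : (Matrix (Fin 2) (Fin 2) ℂ)ˣ) : Matrix (Fin 2) (Fin 2) ℂ) :=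
      fun b hs ht => hpU b (by rw [iterBlockOf_succ]; exact hs) (by rw [iterBlockOf_succ]; exact ht)
    have hF : ∀ e : PBond P i, e.src ∈ S' → e.tgt ∈ S' → p ((dbarIterU i U e : (Matrix (Fin 2) (Fin 2) ℂ)ˣ) : Matrix (Fin 2) (Fin 2) ℂ) :=
      ih (Nat.le_of_succ_le hi) S' U s₀ hs₀ hbudget_i hU' hpU'
    -- near-flatness of the level-`i` double-bar field under `S`
    have hnear : ∀ e : PBond P i, e.src ∈ S' → e.tgt ∈ S' →
        ‖((dbarIterU i U e : (Matrix (Fin 2) (Fin 2) ℂ)ˣ) : Matrix (Fin 2) (Fin 2) ℂ) - 1‖ ≤ 2 * ((P.L : ℝ) ^ i * s₀) :=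
      fun e hs ht => norm_dbarIterU_sub_one_le_two_mul₀ (Nat.le_of_succ_le hi) S' U hs₀ hbudget_i hU' e hs ht
    rw [dbarIterU_succ]
    have hmem : ∀ b : PBond P i, (blockOf b.src = c.src ∨ blockOf b.src = c.tgt) → (blockOf b.tgt = c.src ∨ blockOf b.tgt = c.tgt) →
        b.src ∈ S' ∧ b.tgt ∈ S' := by
      intro b hbs hbt
      constructor
      · show blockOf b.src ∈ S
        rcases hbs with h | h <;> rw [h]
        exacts [hcs, hct]
      · show blockOf b.tgt ∈ S
        rcases hbt with h | h <;> rw [h]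
        exacts [hcs, hct]
    -- the smallness `12ℓ·(2Lⁱs₀) ≤ 1`
    have h2x : 0 ≤ 2 * ((P.L : ℝ) ^ i * s₀) := by positivity
    have h12 : 12 * (((P.d + 2) * P.L : ℕ) : ℝ) * (2 * ((P.L : ℝ) ^ i * s₀)) ≤ 1 := by
      rw [← hℓ]
      have hx0 : 0 ≤ (P.L : ℝ) ^ i * s₀ := by positivity
      have hb' : 8 * 3800 * ℓ ^ 2 * ((P.L : ℝ) ^ i * s₀) ≤ 1 := by
        have : 8 * 3800 * ℓ ^ 2 * ((P.L : ℝ) ^ i * s₀) = 8 * 3800 * ℓ ^ 2 * (P.L : ℝ) ^ i * s₀ := by ring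
        rw [this]; exact hbudget_i
      nlinarith [mul_le_mul_of_nonneg_right hℓ1 (by positivity : (0 : ℝ) ≤ ℓ * ((P.L : ℝ) ^ i * s₀))]
    exact pred_dbarAvgU p h1 hmul hinv heml hi c h2x h12 (fun b hbs hbt => hnear b (hmem b hbs hbt).1 (hmem b hbs hbt).2)
      fun b hbs hbt => hF b (hmem b hbs hbt).1 (hmem b hbs hbt).2

/-- the inverse of a unit of determinant one has determinant one. [folklore] -/
theorem det_coe_units_inv_eq_one {u : (Matrix (Fin 2) (Fin 2) ℂ)ˣ} (h : (u : Matrix (Fin 2) (Fin 2) ℂ).det = 1) :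
    ((u⁻¹ : (Matrix (Fin 2) (Fin 2) ℂ)ˣ) : Matrix (Fin 2) (Fin 2) ℂ).det = 1 := by
  have hmul := congrArg Matrix.det u.mul_inv
  rw [Matrix.det_mul, h, one_mul, Matrix.det_one] at hmul
  exact hmul

/-- the inverse of a unitary unit is unitary. [folklore] -/
theorem coe_units_inv_mem_unitaryGroup {u : (Matrix (Fin 2) (Fin 2) ℂ)ˣ} (h : (u : Matrix (Fin 2) (Fin 2) ℂ) ∈ Matrix.unitaryGroup (Fin 2) ℂ) :
    ((u⁻¹ : (Matrix (Fin 2) (Fin 2) ℂ)ˣ) : Matrix (Fin 2) (Fin 2) ℂ) ∈ Matrix.unitaryGroup (Fin 2) ℂ := by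
  have hinv : ((u⁻¹ : (Matrix (Fin 2) (Fin 2) ℂ)ˣ) : Matrix (Fin 2) (Fin 2) ℂ) = star (u : Matrix (Fin 2) (Fin 2) ℂ) :=
    Units.inv_eq_of_mul_eq_one_right (Unitary.mul_star_self_of_mem h)
  rw [hinv]
  exact Unitary.star_mem h

/-- **`det U̿^{(i)}(e) = 1` ON THE READ TERRITORY** for a field of determinant-one bond variables (✓`ExpMeanLog.det_eml_eq_one`; `card = 2` makes the winding guard automatic).
[cite: Balaban1987RG1, before (0.5) p.253] -/
theorem det_dbarIterU_eq_one_of_reads {i : ℕ} (hi : i ≤ P.m + P.K) (S : Set (Site P i)) (U : GaugeField P 0 (Matrix (Fin 2) (Fin 2) ℂ)ˣ) {s₀ : ℝ}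
    (hs₀ : 0 ≤ s₀) (hbudget : 8 * 3800 * (((P.d + 2) * P.L : ℕ) : ℝ) ^ 2 * (P.L : ℝ) ^ i * s₀ ≤ 1)
    (hU : ∀ b : PBond P 0, iterBlockOf i b.src ∈ S → iterBlockOf i b.tgt ∈ S → ‖((U b : (Matrix (Fin 2) (Fin 2) ℂ)ˣ) : Matrix (Fin 2) (Fin 2) ℂ) - 1‖ ≤ s₀)
    (hdet : ∀ b : PBond P 0, iterBlockOf i b.src ∈ S → iterBlockOf i b.tgt ∈ S → ((U b : (Matrix (Fin 2) (Fin 2) ℂ)ˣ) : Matrix (Fin 2) (Fin 2) ℂ).det = 1)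
    (e : PBond P i) (hs : e.src ∈ S) (ht : e.tgt ∈ S) :
    ((dbarIterU i U e : (Matrix (Fin 2) (Fin 2) ℂ)ˣ) : Matrix (Fin 2) (Fin 2) ℂ).det = 1 :=
  pred_dbarIterU_of_reads (fun M : Matrix (Fin 2) (Fin 2) ℂ => M.det = 1) Matrix.det_one
    (fun _ _ ha hb => by rw [Matrix.det_mul, ha, hb, one_mul]) (fun _ hu => det_coe_units_inv_eq_one hu)
    (fun _ hW hs' => det_eml_eq_one hW hs' fun i' => two_mul_lt_pi_of_le_third (hs' i')) i hi S U s₀ hs₀ hbudget hU hdet e hs ht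

/-- **`U̿^{(i)}(e)` IS UNITARY ON THE READ TERRITORY** for a field of unitary bond variables (✓`ExpMeanLog.eml_mem_unitaryGroup`). [cite: Balaban1987RG1, (0.9) p.253] -/
theorem dbarIterU_mem_unitaryGroup_of_reads {i : ℕ} (hi : i ≤ P.m + P.K) (S : Set (Site P i)) (U : GaugeField P 0 (Matrix (Fin 2) (Fin 2) ℂ)ˣ) {s₀ : ℝ}
    (hs₀ : 0 ≤ s₀) (hbudget : 8 * 3800 * (((P.d + 2) * P.L : ℕ) : ℝ) ^ 2 * (P.L : ℝ) ^ i * s₀ ≤ 1)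
    (hU : ∀ b : PBond P 0, iterBlockOf i b.src ∈ S → iterBlockOf i b.tgt ∈ S → ‖((U b : (Matrix (Fin 2) (Fin 2) ℂ)ˣ) : Matrix (Fin 2) (Fin 2) ℂ) - 1‖ ≤ s₀)
    (hun : ∀ b : PBond P 0, iterBlockOf i b.src ∈ S → iterBlockOf i b.tgt ∈ S →
      ((U b : (Matrix (Fin 2) (Fin 2) ℂ)ˣ) : Matrix (Fin 2) (Fin 2) ℂ) ∈ Matrix.unitaryGroup (Fin 2) ℂ)
    (e : PBond P i) (hs : e.src ∈ S) (ht : e.tgt ∈ S) :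
    ((dbarIterU i U e : (Matrix (Fin 2) (Fin 2) ℂ)ˣ) : Matrix (Fin 2) (Fin 2) ℂ) ∈ Matrix.unitaryGroup (Fin 2) ℂ :=
  pred_dbarIterU_of_reads (fun M : Matrix (Fin 2) (Fin 2) ℂ => M ∈ Matrix.unitaryGroup (Fin 2) ℂ) (Submonoid.one_mem _)
    (fun _ _ ha hb => Submonoid.mul_mem _ ha hb) (fun _ hu => coe_units_inv_mem_unitaryGroup hu)
    (fun _ hW hs' => eml_mem_unitaryGroup hW hs') i hi S U s₀ hs₀ hbudget hU hun e hs ht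

/-- **`det e^{iηA(b)} = 1` FOR TRACELESS `A(b)`** (Liouville: `det e^X = e^{tr X}`). [cite: Balaban1985Variational, (152) p.301] -/
theorem det_coe_expCfg_eq_one (η : ℝ) {A : PBond P 0 → Matrix (Fin 2) (Fin 2) ℂ} (b : PBond P 0) (hA : Matrix.trace (A b) = 0) :
    ((expCfg η A b : (Matrix (Fin 2) (Fin 2) ℂ)ˣ) : Matrix (Fin 2) (Fin 2) ℂ).det = 1 := by
  letI : NormedAlgebra ℚ (Matrix (Fin 2) (Fin 2) ℂ) := NormedAlgebra.restrictScalars ℚ ℂ _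
  rw [coe_expCfg, Literature.Analysis.Matrix.det_exp_eq_exp_trace, Matrix.trace_smul, hA, smul_zero, exp_zero]

/-- **`e^{iηA(b)}` IS UNITARY FOR SELF-ADJOINT `A(b)`** (`iηA(b)` is skew-adjoint). [cite: Balaban1985Averaging, (23) p.21] -/
theorem coe_expCfg_mem_unitaryGroup (η : ℝ) {A : PBond P 0 → Matrix (Fin 2) (Fin 2) ℂ} (b : PBond P 0) (hA : IsSelfAdjoint (A b)) :
    ((expCfg η A b : (Matrix (Fin 2) (Fin 2) ℂ)ˣ) : Matrix (Fin 2) (Fin 2) ℂ) ∈ Matrix.unitaryGroup (Fin 2) ℂ := by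
  letI : NormedAlgebra ℚ (Matrix (Fin 2) (Fin 2) ℂ) := NormedAlgebra.restrictScalars ℚ ℂ _
  rw [coe_expCfg]
  refine exp_mem_unitary_of_mem_skewAdjoint (skewAdjoint.mem_iff.2 ?_)
  rw [star_smul, hA.star_eq, Complex.star_def, map_mul, Complex.conj_I, Complex.conj_ofReal, neg_mul, neg_smul]

/-! ## §3 The two hygiene rows -/

/-- **`Q♭` OF TRACELESS DATA IS TRACELESS (index form, guarded)**: for bondwise-traceless `A₀` whose charted bond variables read by the index `(j, c)` are within `s₀` of `1`,
`30400·ℓ²·Lʲ·s₀ ≤ 1`: `tr (chartLogFlat η D A₀ (j,c)) = 0` (`det U̿^{(j)} = 1`, `‖U̿^{(j)} − 1‖ ≤ 2Lʲs₀ ≤ 1∕3`, ✓`trace_mlog_eq_zero_of_det_eq_one`).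
[cite: Balaban1985Variational, (20) p.281, (152) p.301; Balaban1987RG1, (0.9) p.253] -/
theorem trace_chartLogFlat_eq_zero_of_reads (η : ℝ) (D : Domains P) (idx : BondIdx D) (A₀ : PBond P 0 → Matrix (Fin 2) (Fin 2) ℂ) {s₀ : ℝ} (hs₀ : 0 ≤ s₀)
    (hbudget : 8 * 3800 * (((P.d + 2) * P.L : ℕ) : ℝ) ^ 2 * (P.L : ℝ) ^ (idx.1.1 : ℕ) * s₀ ≤ 1)
    (hA : ∀ b : PBond P 0, (iterBlockOf (idx.1.1 : ℕ) b.src = idx.1.2.src ∨ iterBlockOf (idx.1.1 : ℕ) b.src = idx.1.2.tgt) →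
      (iterBlockOf (idx.1.1 : ℕ) b.tgt = idx.1.2.src ∨ iterBlockOf (idx.1.1 : ℕ) b.tgt = idx.1.2.tgt) →
      ‖((expCfg η A₀ b : (Matrix (Fin 2) (Fin 2) ℂ)ˣ) : Matrix (Fin 2) (Fin 2) ℂ) - 1‖ ≤ s₀)
    (htr : ∀ b : PBond P 0, (iterBlockOf (idx.1.1 : ℕ) b.src = idx.1.2.src ∨ iterBlockOf (idx.1.1 : ℕ) b.src = idx.1.2.tgt) →
      (iterBlockOf (idx.1.1 : ℕ) b.tgt = idx.1.2.src ∨ iterBlockOf (idx.1.1 : ℕ) b.tgt = idx.1.2.tgt) → Matrix.trace (A₀ b) = 0) :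
    Matrix.trace (chartLogFlat η D A₀ idx) = 0 := by
  have hj : (idx.1.1 : ℕ) ≤ P.m + P.K := (Nat.lt_succ_iff.mp idx.1.1.isLt).trans D.hk
  set S : Set (Site P (idx.1.1 : ℕ)) := {y | y = idx.1.2.src ∨ y = idx.1.2.tgt} with hS
  have hA' : ∀ b : PBond P 0, iterBlockOf (idx.1.1 : ℕ) b.src ∈ S → iterBlockOf (idx.1.1 : ℕ) b.tgt ∈ S →
      ‖((expCfg η A₀ b : (Matrix (Fin 2) (Fin 2) ℂ)ˣ) : Matrix (Fin 2) (Fin 2) ℂ) - 1‖ ≤ s₀ := fun b hs ht => hA b hs ht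
  have hdet' : ∀ b : PBond P 0, iterBlockOf (idx.1.1 : ℕ) b.src ∈ S → iterBlockOf (idx.1.1 : ℕ) b.tgt ∈ S →
      ((expCfg η A₀ b : (Matrix (Fin 2) (Fin 2) ℂ)ˣ) : Matrix (Fin 2) (Fin 2) ℂ).det = 1 := fun b hs ht => det_coe_expCfg_eq_one η b (htr b hs ht)
  have hnear := norm_dbarIterU_sub_one_le_two_mul₀ hj S (expCfg η A₀) hs₀ hbudget hA' idx.1.2 (Or.inl rfl) (Or.inr rfl)
  have hdet := det_dbarIterU_eq_one_of_reads hj S (expCfg η A₀) hs₀ hbudget hA' hdet' idx.1.2 (Or.inl rfl) (Or.inr rfl)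
  have hℓ1 : (1 : ℝ) ≤ (((P.d + 2) * P.L : ℕ) : ℝ) := by
    exact_mod_cast Nat.one_le_iff_ne_zero.mpr (Nat.mul_ne_zero (by omega) (by have := P.hL.2; omega))
  have hthird : ‖((dbarIterU (idx.1.1 : ℕ) (expCfg η A₀) idx.1.2 : (Matrix (Fin 2) (Fin 2) ℂ)ˣ) : Matrix (Fin 2) (Fin 2) ℂ) - 1‖ ≤ 1 / 3 := by
    refine hnear.trans ?_
    have h0 : 0 ≤ (P.L : ℝ) ^ (idx.1.1 : ℕ) * s₀ := by positivity
    have h1 : 8 * 3800 * (((P.d + 2) * P.L : ℕ) : ℝ) ^ 2 * ((P.L : ℝ) ^ (idx.1.1 : ℕ) * s₀) ≤ 1 := by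
      have : 8 * 3800 * (((P.d + 2) * P.L : ℕ) : ℝ) ^ 2 * ((P.L : ℝ) ^ (idx.1.1 : ℕ) * s₀) =
          8 * 3800 * (((P.d + 2) * P.L : ℕ) : ℝ) ^ 2 * (P.L : ℝ) ^ (idx.1.1 : ℕ) * s₀ := by ring
      rw [this]; exact hbudget
    nlinarith [(one_le_pow₀ (M₀ := ℝ) hℓ1 : (1:ℝ) ≤ _ ^ 2)]
  rw [chartLogFlat_apply, Matrix.trace_smul, trace_mlog_eq_zero_of_det_eq_one hdet hthird (two_mul_lt_pi_of_le_third hthird), smul_zero]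

/-- **`Q♭` OF SELF-ADJOINT DATA IS SELF-ADJOINT (index form, guarded)**: for bondwise-self-adjoint `A₀` read within `s₀` of `1`, `30400·ℓ²·Lʲ·s₀ ≤ 1`:
`chartLogFlat η D A₀ (j,c)` is self-adjoint (`U̿^{(j)}` unitary, `(log U̿)* = −log U̿` by ✓`star_mlog_eq_neg`, `(−i·log U̿)* = −i·log U̿`).
[cite: Balaban1985Averaging, (23) p.21; Balaban1985Variational, (20) p.281] -/
theorem isSelfAdjoint_chartLogFlat_of_reads (η : ℝ) (D : Domains P) (idx : BondIdx D) (A₀ : PBond P 0 → Matrix (Fin 2) (Fin 2) ℂ) {s₀ : ℝ} (hs₀ : 0 ≤ s₀)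
    (hbudget : 8 * 3800 * (((P.d + 2) * P.L : ℕ) : ℝ) ^ 2 * (P.L : ℝ) ^ (idx.1.1 : ℕ) * s₀ ≤ 1)
    (hA : ∀ b : PBond P 0, (iterBlockOf (idx.1.1 : ℕ) b.src = idx.1.2.src ∨ iterBlockOf (idx.1.1 : ℕ) b.src = idx.1.2.tgt) →
      (iterBlockOf (idx.1.1 : ℕ) b.tgt = idx.1.2.src ∨ iterBlockOf (idx.1.1 : ℕ) b.tgt = idx.1.2.tgt) →
      ‖((expCfg η A₀ b : (Matrix (Fin 2) (Fin 2) ℂ)ˣ) : Matrix (Fin 2) (Fin 2) ℂ) - 1‖ ≤ s₀)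
    (hsa : ∀ b : PBond P 0, (iterBlockOf (idx.1.1 : ℕ) b.src = idx.1.2.src ∨ iterBlockOf (idx.1.1 : ℕ) b.src = idx.1.2.tgt) →
      (iterBlockOf (idx.1.1 : ℕ) b.tgt = idx.1.2.src ∨ iterBlockOf (idx.1.1 : ℕ) b.tgt = idx.1.2.tgt) → IsSelfAdjoint (A₀ b)) :
    IsSelfAdjoint (chartLogFlat η D A₀ idx) := by
  have hj : (idx.1.1 : ℕ) ≤ P.m + P.K := (Nat.lt_succ_iff.mp idx.1.1.isLt).trans D.hk
  set S : Set (Site P (idx.1.1 : ℕ)) := {y | y = idx.1.2.src ∨ y = idx.1.2.tgt} with hS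
  have hA' : ∀ b : PBond P 0, iterBlockOf (idx.1.1 : ℕ) b.src ∈ S → iterBlockOf (idx.1.1 : ℕ) b.tgt ∈ S →
      ‖((expCfg η A₀ b : (Matrix (Fin 2) (Fin 2) ℂ)ˣ) : Matrix (Fin 2) (Fin 2) ℂ) - 1‖ ≤ s₀ := fun b hs ht => hA b hs ht
  have hun' : ∀ b : PBond P 0, iterBlockOf (idx.1.1 : ℕ) b.src ∈ S → iterBlockOf (idx.1.1 : ℕ) b.tgt ∈ S →
      ((expCfg η A₀ b : (Matrix (Fin 2) (Fin 2) ℂ)ˣ) : Matrix (Fin 2) (Fin 2) ℂ) ∈ Matrix.unitaryGroup (Fin 2) ℂ :=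
    fun b hs ht => coe_expCfg_mem_unitaryGroup η b (hsa b hs ht)
  have hnear := norm_dbarIterU_sub_one_le_two_mul₀ hj S (expCfg η A₀) hs₀ hbudget hA' idx.1.2 (Or.inl rfl) (Or.inr rfl)
  have hun := dbarIterU_mem_unitaryGroup_of_reads hj S (expCfg η A₀) hs₀ hbudget hA' hun' idx.1.2 (Or.inl rfl) (Or.inr rfl)
  have hℓ1 : (1 : ℝ) ≤ (((P.d + 2) * P.L : ℕ) : ℝ) := by
    exact_mod_cast Nat.one_le_iff_ne_zero.mpr (Nat.mul_ne_zero (by omega) (by have := P.hL.2; omega))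
  have hthird : ‖((dbarIterU (idx.1.1 : ℕ) (expCfg η A₀) idx.1.2 : (Matrix (Fin 2) (Fin 2) ℂ)ˣ) : Matrix (Fin 2) (Fin 2) ℂ) - 1‖ ≤ 1 / 3 := by
    refine hnear.trans ?_
    have h0 : 0 ≤ (P.L : ℝ) ^ (idx.1.1 : ℕ) * s₀ := by positivity
    have h1 : 8 * 3800 * (((P.d + 2) * P.L : ℕ) : ℝ) ^ 2 * ((P.L : ℝ) ^ (idx.1.1 : ℕ) * s₀) ≤ 1 := by
      have : 8 * 3800 * (((P.d + 2) * P.L : ℕ) : ℝ) ^ 2 * ((P.L : ℝ) ^ (idx.1.1 : ℕ) * s₀) =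
          8 * 3800 * (((P.d + 2) * P.L : ℕ) : ℝ) ^ 2 * (P.L : ℝ) ^ (idx.1.1 : ℕ) * s₀ := by ring
      rw [this]; exact hbudget
    nlinarith [(one_le_pow₀ (M₀ := ℝ) hℓ1 : (1:ℝ) ≤ _ ^ 2)]
  have hstar := star_mlog_eq_neg hun hthird
  show star (chartLogFlat η D A₀ idx) = chartLogFlat η D A₀ idx
  rw [chartLogFlat_apply, star_smul, hstar, star_neg, Complex.star_def, Complex.conj_I, neg_neg, smul_neg, neg_smul]

/-! ### The weighted-ball forms of record (letters of ✓`norm_chartLogFlat_le_weightedBall₀`) -/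

/-- **hCtr♭ OF RECORD: ON THE WEIGHTED BALL `Q♭` OF BONDWISE-TRACELESS FIELDS IS TRACELESS** at every index (`60800·ℓ²·L·R ≤ 1`, level weights, collar).
[cite: Balaban1985Variational, (20) p.281, (44)-(47) p.285, (152) p.301] -/
theorem trace_chartLogFlat_eq_zero_weightedBall₀ (F : T3Family) (n K : ℕ) (D : Domains (F.P K)) (hDk : D.k = K - n)
    (hcollar : ∀ (i : ℕ) (e : PBond (F.P K) (i + 1)), D.LamBond (i + 1) e → ∀ z : Site (F.P K) i, (blockOf z = e.src ∨ blockOf z = e.tgt) → z ∈ D.Om i)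
    {w : ℕ → PBond (F.P K) 0 → ℝ} (hw : IsLevWeight F n K D w)
    {R : ℝ} (hR : 16 * 3800 * ((((F.P K).d + 2) * (F.P K).L : ℕ) : ℝ) ^ 2 * (F.L : ℝ) * R ≤ 1)
    {A : PBond (F.P K) 0 → Matrix (Fin 2) (Fin 2) ℂ} (hA : ∀ b, w 1 b * ‖A b‖ < R) (htr : ∀ b, Matrix.trace (A b) = 0) (idx : BondIdx D) :
    Matrix.trace (chartLogFlat (((F.L : ℝ)⁻¹) ^ (K - n)) D A idx) = 0 := by
  have hL1 : (1 : ℝ) ≤ F.L := by exact_mod_cast (F.P K).L_pos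
  have hL0 : (0 : ℝ) < F.L := by linarith
  have hℓ1 : (1 : ℝ) ≤ ((((F.P K).d + 2) * (F.P K).L : ℕ) : ℝ) := by
    exact_mod_cast Nat.one_le_iff_ne_zero.mpr (Nat.mul_ne_zero (by omega) (by have := (F.P K).hL.2; omega))
  have hLj : 0 < (F.L : ℝ) ^ (idx.1.1 : ℕ) := by positivity
  have hR0 : 0 ≤ R := by
    have := hA (⟨fun _ => 0, idx.1.2.dir⟩ : PBond (F.P K) 0)
    have hw0 : 0 ≤ w 1 ⟨fun _ => 0, idx.1.2.dir⟩ * ‖A ⟨fun _ => 0, idx.1.2.dir⟩‖ := by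
      rw [hw 1, pow_one]; exact mul_nonneg (by positivity) (norm_nonneg _)
    linarith
  have hLR : (F.L : ℝ) * R ≤ 1 := by
    have h16 : (1 : ℝ) ≤ 16 * 3800 * ((((F.P K).d + 2) * (F.P K).L : ℕ) : ℝ) ^ 2 := by
      nlinarith [(one_le_pow₀ (M₀ := ℝ) hℓ1 : (1:ℝ) ≤ _ ^ 2)]
    nlinarith [mul_nonneg hL0.le hR0]
  set s₀ : ℝ := 2 * (F.L : ℝ) * R * ((F.L : ℝ) ^ (idx.1.1 : ℕ))⁻¹ with hs₀
  have hs₀0 : 0 ≤ s₀ := by positivity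
  have hbudget : 8 * 3800 * ((((F.P K).d + 2) * (F.P K).L : ℕ) : ℝ) ^ 2 * (F.L : ℝ) ^ (idx.1.1 : ℕ) * s₀ ≤ 1 := by
    have : 8 * 3800 * ((((F.P K).d + 2) * (F.P K).L : ℕ) : ℝ) ^ 2 * (F.L : ℝ) ^ (idx.1.1 : ℕ) * s₀ =
        16 * 3800 * ((((F.P K).d + 2) * (F.P K).L : ℕ) : ℝ) ^ 2 * (F.L : ℝ) * R := by
      rw [hs₀]; field_simp; ring
    rw [this]; exact hR
  have hA' : ∀ b : PBond (F.P K) 0, (iterBlockOf (idx.1.1 : ℕ) b.src = idx.1.2.src ∨ iterBlockOf (idx.1.1 : ℕ) b.src = idx.1.2.tgt) →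
      (iterBlockOf (idx.1.1 : ℕ) b.tgt = idx.1.2.src ∨ iterBlockOf (idx.1.1 : ℕ) b.tgt = idx.1.2.tgt) →
      ‖((expCfg (((F.L : ℝ)⁻¹) ^ (K - n)) A b : (Matrix (Fin 2) (Fin 2) ℂ)ˣ) : Matrix (Fin 2) (Fin 2) ℂ) - 1‖ ≤ s₀ :=
    fun b hb _ => norm_expCfg_sub_one_le_of_weightedBall_flat F n K D hDk hcollar hw hLR hA idx b hb
  have hLF : ((F.P K).L : ℝ) = F.L := by norm_cast
  exact trace_chartLogFlat_eq_zero_of_reads (((F.L : ℝ)⁻¹) ^ (K - n)) D idx A hs₀0 (by rw [hLF]; exact hbudget) hA' fun b _ _ => htr b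

/-- **hΨ♭ OF RECORD: ON THE WEIGHTED BALL `Q♭` OF BONDWISE-SELF-ADJOINT FIELDS IS SELF-ADJOINT** at every index (`60800·ℓ²·L·R ≤ 1`, level weights, collar).
[cite: Balaban1985Averaging, (23) p.21; Balaban1985Variational, (20) p.281, (152) p.301] -/
theorem isSelfAdjoint_chartLogFlat_weightedBall₀ (F : T3Family) (n K : ℕ) (D : Domains (F.P K)) (hDk : D.k = K - n)
    (hcollar : ∀ (i : ℕ) (e : PBond (F.P K) (i + 1)), D.LamBond (i + 1) e → ∀ z : Site (F.P K) i, (blockOf z = e.src ∨ blockOf z = e.tgt) → z ∈ D.Om i)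
    {w : ℕ → PBond (F.P K) 0 → ℝ} (hw : IsLevWeight F n K D w)
    {R : ℝ} (hR : 16 * 3800 * ((((F.P K).d + 2) * (F.P K).L : ℕ) : ℝ) ^ 2 * (F.L : ℝ) * R ≤ 1)
    {A : PBond (F.P K) 0 → Matrix (Fin 2) (Fin 2) ℂ} (hA : ∀ b, w 1 b * ‖A b‖ < R) (hsa : ∀ b, IsSelfAdjoint (A b)) (idx : BondIdx D) :
    IsSelfAdjoint (chartLogFlat (((F.L : ℝ)⁻¹) ^ (K - n)) D A idx) := by
  have hL1 : (1 : ℝ) ≤ F.L := by exact_mod_cast (F.P K).L_pos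
  have hL0 : (0 : ℝ) < F.L := by linarith
  have hℓ1 : (1 : ℝ) ≤ ((((F.P K).d + 2) * (F.P K).L : ℕ) : ℝ) := by
    exact_mod_cast Nat.one_le_iff_ne_zero.mpr (Nat.mul_ne_zero (by omega) (by have := (F.P K).hL.2; omega))
  have hLj : 0 < (F.L : ℝ) ^ (idx.1.1 : ℕ) := by positivity
  have hR0 : 0 ≤ R := by
    have := hA (⟨fun _ => 0, idx.1.2.dir⟩ : PBond (F.P K) 0)
    have hw0 : 0 ≤ w 1 ⟨fun _ => 0, idx.1.2.dir⟩ * ‖A ⟨fun _ => 0, idx.1.2.dir⟩‖ := by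
      rw [hw 1, pow_one]; exact mul_nonneg (by positivity) (norm_nonneg _)
    linarith
  have hLR : (F.L : ℝ) * R ≤ 1 := by
    have h16 : (1 : ℝ) ≤ 16 * 3800 * ((((F.P K).d + 2) * (F.P K).L : ℕ) : ℝ) ^ 2 := by
      nlinarith [(one_le_pow₀ (M₀ := ℝ) hℓ1 : (1:ℝ) ≤ _ ^ 2)]
    nlinarith [mul_nonneg hL0.le hR0]
  set s₀ : ℝ := 2 * (F.L : ℝ) * R * ((F.L : ℝ) ^ (idx.1.1 : ℕ))⁻¹ with hs₀
  have hs₀0 : 0 ≤ s₀ := by positivity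
  have hbudget : 8 * 3800 * ((((F.P K).d + 2) * (F.P K).L : ℕ) : ℝ) ^ 2 * (F.L : ℝ) ^ (idx.1.1 : ℕ) * s₀ ≤ 1 := by
    have : 8 * 3800 * ((((F.P K).d + 2) * (F.P K).L : ℕ) : ℝ) ^ 2 * (F.L : ℝ) ^ (idx.1.1 : ℕ) * s₀ =
        16 * 3800 * ((((F.P K).d + 2) * (F.P K).L : ℕ) : ℝ) ^ 2 * (F.L : ℝ) * R := by
      rw [hs₀]; field_simp; ring
    rw [this]; exact hR
  have hA' : ∀ b : PBond (F.P K) 0, (iterBlockOf (idx.1.1 : ℕ) b.src = idx.1.2.src ∨ iterBlockOf (idx.1.1 : ℕ) b.src = idx.1.2.tgt) →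
      (iterBlockOf (idx.1.1 : ℕ) b.tgt = idx.1.2.src ∨ iterBlockOf (idx.1.1 : ℕ) b.tgt = idx.1.2.tgt) →
      ‖((expCfg (((F.L : ℝ)⁻¹) ^ (K - n)) A b : (Matrix (Fin 2) (Fin 2) ℂ)ˣ) : Matrix (Fin 2) (Fin 2) ℂ) - 1‖ ≤ s₀ :=
    fun b hb _ => norm_expCfg_sub_one_le_of_weightedBall_flat F n K D hDk hcollar hw hLR hA idx b hb
  have hLF : ((F.P K).L : ℝ) = F.L := by norm_cast
  exact isSelfAdjoint_chartLogFlat_of_reads (((F.L : ℝ)⁻¹) ^ (K - n)) D idx A hs₀0 (by rw [hLF]; exact hbudget) hA' fun b _ _ => hsa b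

end SU2

end Summit.QuantumFields.YangMills.Theorems.Prop8ChartDoubleBar

end
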